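import Summits.ValiantsHypothesis.ValiantsHypothesis.Theorems.LacunarySymmetroidMatrixDescartesCensusDoorA34ConfluentNineKernel
import Summits.ValiantsHypothesis.ValiantsHypothesis.Theorems.LacunarySymmetroidMatrixDescartesCensusDoorA34NoNinefold

/-!
# `MatrixDescartes` census — DOOR A at `(3,4)`: THE CONFLUENT NINE, part 3 — the CONFLUENT COEFFICIENT TABLE (all supports),
# Newton's inequality `3e₁e₃ ≤ e₂²` for real symmetric `3 × 3` matrices, and polarisation of `e₂`, `det` along two letters

HONEST FRAMING.  Object-search cell `pub-symmetroid`, door-A seat `val-sym-door-p3` (g25); helper file beside the OPEN typed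
statement `DoorA34 = PosRootLawAt 3 4 18` (route item `Theses.LacunarySymmetroid.DoorA34`, stmt-ValiantsHypothesis-19980),
asserted nowhere here.  Continuation of parts 1–2 (`…ConfluentNineKernel`, `…ConfluentNine`); the tools of this part feed part 4
(`…ConfluentNineNewton`: no ninefold root in chamber I and in chamber III up to `10d₂ ≤ 19d₁`).

* **`confluent_coefficients`** (ALL supports `0 < d₁, 0 < d₂`, ANY real `3 × 3` letters): if `(X − 1)⁹ ∣ det(1 + X^{d₁}S₁ + X^{d₂}S₂)`
  then the nine mixed invariants `tr S₁, tr S₂, e₂S₁, e₂(S₁,S₂), e₂S₂, det S₁, tr(adj S₁·S₂), tr(adj S₂·S₁), det S₂` satisfy the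
  cleared closed forms `c_{jk}·m_{jk}(d₁,d₂) = n_{jk}(d₁,d₂)` — THE CONFLUENT COEFFICIENT TABLE (the reduced confluent Vandermonde
  kernel; e.g. `tr S₁·(d₂−d₁)(2d₂−d₁)(3d₂−d₁) = −9d₂(d₂+2d₁)(2d₂+d₁)`,
  `det S₂·(d₂−d₁)³(2d₂−d₁)(3d₂−d₁)(3d₂−2d₁) = −d₁³(d₂+d₁)(d₂+2d₁)(2d₂+d₁)`); each row is `two_point_relation'` of part 1 with the
  common factor (a monomial in `d₁, d₂, d₁+d₂`) cancelled.
* **`newton_two_of_isSymm`**: `3·tr A·det A ≤ e₂(A)²` for real symmetric `A` (spectral theorem as in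
  `NoNinefold.discr_charpoly_nonneg_of_isSymm`, then `(ab+ac+bc)² − 3(a+b+c)abc = ½Σ(ab−bc)² ≥ 0`).
* `e2_lin_comb`, `det_lin_comb`: `e₂` and `det` of `α·A + β·B` in the mixed invariants.

Nothing here bounds `ζ_sym(3,3)` or `ζ_sym(3,4)`; `DoorA34`, Claim L and `MatrixDescartes` (stmt-ValiantsHypothesis-18050) stay OPEN;
registers unchanged; nothing on `VP ≠ VNP`.
[folklore] Newton's inequalities, spectral theorem, divided differences; certificates by `ring` / `linear_combination`.
-/

-- `Summit.ValiantsHypothesis.ValiantsHypothesis.…` repeats a component by the D-0017 layout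
-- (single-conjunct summit), which the `dupNamespace` linter flags; the name is mandated.
set_option linter.dupNamespace false

namespace Summit.ValiantsHypothesis.ValiantsHypothesis.Theorems.LacunarySymmetroidMatrixDescartes.Census.ConfluentNine

open Polynomial Finset
open scoped BigOperators

/-! ## 1. Newton's inequality `3e₁e₃ ≤ e₂²` for real symmetric `3 × 3` matrices -/

/-- Newton's inequality for three reals: `3(a+b+c)abc ≤ (ab+ac+bc)²`. [folklore] -/
theorem newton_two_real (a b c : ℝ) : 3 * (a + b + c) * (a * b * c) ≤ (a * b + a * c + b * c) ^ 2 := by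
  nlinarith [sq_nonneg (a * b - a * c), sq_nonneg (a * b - b * c), sq_nonneg (a * c - b * c)]

/-- **Newton's inequality for a real SYMMETRIC `3 × 3` matrix**: `3·tr A·det A ≤ e₂(A)²` (all eigenvalues real). [folklore] -/
theorem newton_two_of_isSymm (A : Matrix (Fin 3) (Fin 3) ℝ) (hA : A.IsSymm) :
    3 * A.trace * A.det ≤ (A 0 0 * A 1 1 - A 0 1 * A 1 0 + (A 0 0 * A 2 2 - A 0 2 * A 2 0) + (A 1 1 * A 2 2 - A 1 2 * A 2 1)) ^ 2 := by
  have hH : A.IsHermitian := by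
    unfold Matrix.IsHermitian
    rw [Matrix.conjTranspose_eq_transpose_of_trivial]
    exact hA
  have h1 := Matrix.charpoly_fin_three A
  have h2 := hH.charpoly_eq
  rw [Fin.prod_univ_three] at h2
  simp only [RCLike.ofReal_real_eq_id, id_eq] at h2
  rw [NoNinefold.prod_X_sub_C_three] at h2
  rw [h1] at h2
  obtain ⟨htr, he2, hdet⟩ := NoNinefold.cubic_coeffs_eq h2
  rw [htr, he2, hdet]
  exact newton_two_real _ _ _

/-! ## 2. The confluent coefficient table (all supports) -/

/-- **THE CONFLUENT COEFFICIENT TABLE.**  For ANY real `3 × 3` letters `S₁, S₂` and any `0 < d₁, 0 < d₂`: if `(X − 1)⁹` divides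
`det(1 + X^{d₁}S₁ + X^{d₂}S₂)`, then the nine mixed invariants satisfy the cleared closed forms `c_{jk}·m_{jk}(d₁,d₂) = n_{jk}(d₁,d₂)`
listed below (tr S₁, tr S₂, e₂S₁, e₂(S₁,S₂), e₂S₂, det S₁, tr(adj S₁·S₂), tr(adj S₂·S₁), det S₂, in this order); off the walls the
`m_{jk}` are non-zero and these ARE the coefficients of the unique (up to the scaling `X ↦ x₀X`) ten-term fewnomial with a ninefold
root. [folklore] -/
theorem confluent_coefficients (d₁ d₂ : ℕ) (S₁ S₂ : Matrix (Fin 3) (Fin 3) ℝ) (h1 : 0 < d₁) (h2 : 0 < d₂)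
    (h9 : (X - C 1) ^ 9 ∣ (∑ l, (X : ℝ[X]) ^ (![0, d₁, d₂] : Fin 3 → ℕ) l • ((![1, S₁, S₂] : Fin 3 → Matrix (Fin 3) (Fin 3) ℝ) l).map C).det) :
    S₁.trace * (((d₂ : ℝ) - (d₁ : ℝ)) * (2 * (d₂ : ℝ) - (d₁ : ℝ)) * (3 * (d₂ : ℝ) - (d₁ : ℝ))) = (-9 * (d₂ : ℝ) * ((d₂ : ℝ) + 2 * (d₁ : ℝ)) * (2
        * (d₂ : ℝ) + (d₁ : ℝ)))
      ∧ S₂.trace * (((d₂ : ℝ) - (d₁ : ℝ)) * ((d₂ : ℝ) - 2 * (d₁ : ℝ)) * ((d₂ : ℝ) - 3 * (d₁ : ℝ))) = (9 * (d₁ : ℝ) * ((d₂ : ℝ) + 2 * (d₁ : ℝ)) * (2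
          * (d₂ : ℝ) + (d₁ : ℝ)))
      ∧ (S₁ 0 0 * S₁ 1 1 - S₁ 0 1 * S₁ 1 0 + (S₁ 0 0 * S₁ 2 2 - S₁ 0 2 * S₁ 2 0) + (S₁ 1 1 * S₁ 2 2 - S₁ 1 2 * S₁ 2 1)) * (((d₂ : ℝ)
          - (d₁ : ℝ)) ^ 2 * ((d₂ : ℝ) - 2 * (d₁ : ℝ)) * (2 * (d₂ : ℝ) - (d₁ : ℝ)) * (3 * (d₂ : ℝ) - 2 * (d₁ : ℝ))) = (9 * (d₂ : ℝ) ^ 2 * ((d₂ : ℝ)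
          + (d₁ : ℝ)) * ((d₂ : ℝ) + 2 * (d₁ : ℝ)) * (2 * (d₂ : ℝ) + (d₁ : ℝ)))
      ∧ (S₁ 0 0 * S₂ 1 1 + S₂ 0 0 * S₁ 1 1 - S₁ 0 1 * S₂ 1 0 - S₂ 0 1 * S₁ 1 0 + (S₁ 0 0 * S₂ 2 2 + S₂ 0 0 * S₁ 2 2 - S₁ 0 2 * S₂ 2 0 - S₂ 0 2
          * S₁ 2 0) + (S₁ 1 1 * S₂ 2 2 + S₂ 1 1 * S₁ 2 2 - S₁ 1 2 * S₂ 2 1 - S₂ 1 2 * S₁ 2 1)) * (((d₂ : ℝ) - (d₁ : ℝ)) ^ 2 * ((d₂ : ℝ) - 2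
          * (d₁ : ℝ)) * (2 * (d₂ : ℝ) - (d₁ : ℝ))) = (-36 * (d₁ : ℝ) * (d₂ : ℝ) * ((d₂ : ℝ) + 2 * (d₁ : ℝ)) * (2 * (d₂ : ℝ) + (d₁ : ℝ)))
      ∧ (S₂ 0 0 * S₂ 1 1 - S₂ 0 1 * S₂ 1 0 + (S₂ 0 0 * S₂ 2 2 - S₂ 0 2 * S₂ 2 0) + (S₂ 1 1 * S₂ 2 2 - S₂ 1 2 * S₂ 2 1)) * (((d₂ : ℝ)
          - (d₁ : ℝ)) ^ 2 * ((d₂ : ℝ) - 2 * (d₁ : ℝ)) * (2 * (d₂ : ℝ) - (d₁ : ℝ)) * (2 * (d₂ : ℝ) - 3 * (d₁ : ℝ))) = (-9 * (d₁ : ℝ) ^ 2 * ((d₂ : ℝ)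
          + (d₁ : ℝ)) * ((d₂ : ℝ) + 2 * (d₁ : ℝ)) * (2 * (d₂ : ℝ) + (d₁ : ℝ)))
      ∧ S₁.det * (((d₂ : ℝ) - (d₁ : ℝ)) ^ 3 * ((d₂ : ℝ) - 2 * (d₁ : ℝ)) * ((d₂ : ℝ) - 3 * (d₁ : ℝ)) * (2 * (d₂ : ℝ) - 3
          * (d₁ : ℝ))) = (-((d₂ : ℝ) ^ 3) * ((d₂ : ℝ) + (d₁ : ℝ)) * ((d₂ : ℝ) + 2 * (d₁ : ℝ)) * (2 * (d₂ : ℝ) + (d₁ : ℝ)))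
      ∧ (S₁.adjugate * S₂).trace * (((d₂ : ℝ) - (d₁ : ℝ)) ^ 3 * ((d₂ : ℝ) - 2 * (d₁ : ℝ))) = (9 * (d₁ : ℝ) * (d₂ : ℝ) ^ 2 * (2 * (d₂ : ℝ) + (d₁ : ℝ)))
      ∧ (S₂.adjugate * S₁).trace * (((d₂ : ℝ) - (d₁ : ℝ)) ^ 3 * (2 * (d₂ : ℝ) - (d₁ : ℝ))) = (9 * (d₁ : ℝ) ^ 2 * (d₂ : ℝ) * ((d₂ : ℝ) + 2 * (d₁ : ℝ)))
      ∧ S₂.det * (((d₂ : ℝ) - (d₁ : ℝ)) ^ 3 * (2 * (d₂ : ℝ) - (d₁ : ℝ)) * (3 * (d₂ : ℝ) - (d₁ : ℝ)) * (3 * (d₂ : ℝ) - 2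
          * (d₁ : ℝ))) = (-((d₁ : ℝ) ^ 3) * ((d₂ : ℝ) + (d₁ : ℝ)) * ((d₂ : ℝ) + 2 * (d₁ : ℝ)) * (2 * (d₂ : ℝ) + (d₁ : ℝ))) := by
  rw [det_pencil_eq_sum_ten] at h9
  have hcard : (Finset.univ : Finset (Fin 10)).card ≤ 9 + 1 := by rw [Finset.card_univ, Fintype.card_fin]
  have ha : (0 : ℝ) < d₁ := by exact_mod_cast h1
  have hb : (0 : ℝ) < d₂ := by exact_mod_cast h2
  have n_a : (d₁ : ℝ) ≠ 0 := ha.ne'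
  have n_b : (d₂ : ℝ) ≠ 0 := hb.ne'
  have n_apb : (d₁ : ℝ) + (d₂ : ℝ) ≠ 0 := by linarith
  have R1 := two_point_relation' (Finset.univ : Finset (Fin 10)) _ _ h9 hcard (i₀ := 0) (i := 1)
    (Finset.mem_univ _) (Finset.mem_univ _) (by decide)
  simp [Fin.prod_univ_succ] at R1
  have K1 : (4 * (d₁ : ℝ) ^ 2 * (d₂ : ℝ) ^ 2 * ((d₁ : ℝ) + (d₂ : ℝ))) ≠ 0 := 
    mul_ne_zero (mul_ne_zero (mul_ne_zero (by norm_num) (pow_ne_zero _ n_a)) (pow_ne_zero _ n_b)) n_apb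
  have C1 : S₁.trace * (((d₂ : ℝ) - (d₁ : ℝ)) * (2 * (d₂ : ℝ) - (d₁ : ℝ)) * (3 * (d₂ : ℝ) - (d₁ : ℝ))) = (-9 * (d₂ : ℝ) * ((d₂ : ℝ) + 2 * (d₁ : ℝ))
      * (2 * (d₂ : ℝ) + (d₁ : ℝ))) := by
    have e : (4 * (d₁ : ℝ) ^ 2 * (d₂ : ℝ) ^ 2 * ((d₁ : ℝ) + (d₂ : ℝ))) * (S₁.trace * (((d₂ : ℝ) - (d₁ : ℝ)) * (2 * (d₂ : ℝ) - (d₁ : ℝ)) * (3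
        * (d₂ : ℝ) - (d₁ : ℝ))) - (-9 * (d₂ : ℝ) * ((d₂ : ℝ) + 2 * (d₁ : ℝ)) * (2 * (d₂ : ℝ) + (d₁ : ℝ)))) = 0 := by linear_combination R1
    have e2 := (mul_eq_zero.mp e).resolve_left K1
    linarith
  have R2 := two_point_relation' (Finset.univ : Finset (Fin 10)) _ _ h9 hcard (i₀ := 0) (i := 2)
    (Finset.mem_univ _) (Finset.mem_univ _) (by decide)
  simp [Fin.prod_univ_succ] at R2
  have K2 : (-4 * (d₁ : ℝ) ^ 2 * (d₂ : ℝ) ^ 2 * ((d₁ : ℝ) + (d₂ : ℝ))) ≠ 0 := 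
    mul_ne_zero (mul_ne_zero (mul_ne_zero (by norm_num) (pow_ne_zero _ n_a)) (pow_ne_zero _ n_b)) n_apb
  have C2 : S₂.trace * (((d₂ : ℝ) - (d₁ : ℝ)) * ((d₂ : ℝ) - 2 * (d₁ : ℝ)) * ((d₂ : ℝ) - 3 * (d₁ : ℝ))) = (9 * (d₁ : ℝ) * ((d₂ : ℝ) + 2 * (d₁ : ℝ))
      * (2 * (d₂ : ℝ) + (d₁ : ℝ))) := by
    have e : (-4 * (d₁ : ℝ) ^ 2 * (d₂ : ℝ) ^ 2 * ((d₁ : ℝ) + (d₂ : ℝ))) * (S₂.trace * (((d₂ : ℝ) - (d₁ : ℝ)) * ((d₂ : ℝ) - 2 * (d₁ : ℝ))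
        * ((d₂ : ℝ) - 3 * (d₁ : ℝ))) - (9 * (d₁ : ℝ) * ((d₂ : ℝ) + 2 * (d₁ : ℝ)) * (2 * (d₂ : ℝ) + (d₁ : ℝ)))) = 0 := by linear_combination R2
    have e2 := (mul_eq_zero.mp e).resolve_left K2
    linarith
  have R3 := two_point_relation' (Finset.univ : Finset (Fin 10)) _ _ h9 hcard (i₀ := 0) (i := 3)
    (Finset.mem_univ _) (Finset.mem_univ _) (by decide)
  simp [Fin.prod_univ_succ] at R3
  have K3 : (-2 * (d₁ : ℝ) ^ 2 * (d₂ : ℝ)) ≠ 0 := 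
    mul_ne_zero (mul_ne_zero (by norm_num) (pow_ne_zero _ n_a)) n_b
  have C3 : (S₁ 0 0 * S₁ 1 1 - S₁ 0 1 * S₁ 1 0 + (S₁ 0 0 * S₁ 2 2 - S₁ 0 2 * S₁ 2 0) + (S₁ 1 1 * S₁ 2 2 - S₁ 1 2 * S₁ 2 1)) * (((d₂ : ℝ)
      - (d₁ : ℝ)) ^ 2 * ((d₂ : ℝ) - 2 * (d₁ : ℝ)) * (2 * (d₂ : ℝ) - (d₁ : ℝ)) * (3 * (d₂ : ℝ) - 2 * (d₁ : ℝ))) = (9 * (d₂ : ℝ) ^ 2 * ((d₂ : ℝ)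
      + (d₁ : ℝ)) * ((d₂ : ℝ) + 2 * (d₁ : ℝ)) * (2 * (d₂ : ℝ) + (d₁ : ℝ))) := by
    have e : (-2 * (d₁ : ℝ) ^ 2 * (d₂ : ℝ)) * ((S₁ 0 0 * S₁ 1 1 - S₁ 0 1 * S₁ 1 0 + (S₁ 0 0 * S₁ 2 2 - S₁ 0 2 * S₁ 2 0) + (S₁ 1 1 * S₁ 2 2 - S₁ 1 2
        * S₁ 2 1)) * (((d₂ : ℝ) - (d₁ : ℝ)) ^ 2 * ((d₂ : ℝ) - 2 * (d₁ : ℝ)) * (2 * (d₂ : ℝ) - (d₁ : ℝ)) * (3 * (d₂ : ℝ) - 2 * (d₁ : ℝ))) - (9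
        * (d₂ : ℝ) ^ 2 * ((d₂ : ℝ) + (d₁ : ℝ)) * ((d₂ : ℝ) + 2 * (d₁ : ℝ)) * (2 * (d₂ : ℝ) + (d₁ : ℝ)))) = 0 := by linear_combination R3
    have e2 := (mul_eq_zero.mp e).resolve_left K3
    linarith
  have R4 := two_point_relation' (Finset.univ : Finset (Fin 10)) _ _ h9 hcard (i₀ := 0) (i := 4)
    (Finset.mem_univ _) (Finset.mem_univ _) (by decide)
  simp [Fin.prod_univ_succ] at R4
  have K4 : ((d₁ : ℝ) ^ 2 * (d₂ : ℝ) ^ 2) ≠ 0 := 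
    mul_ne_zero (pow_ne_zero _ n_a) (pow_ne_zero _ n_b)
  have C4 : (S₁ 0 0 * S₂ 1 1 + S₂ 0 0 * S₁ 1 1 - S₁ 0 1 * S₂ 1 0 - S₂ 0 1 * S₁ 1 0 + (S₁ 0 0 * S₂ 2 2 + S₂ 0 0 * S₁ 2 2 - S₁ 0 2 * S₂ 2 0 - S₂ 0 2
      * S₁ 2 0) + (S₁ 1 1 * S₂ 2 2 + S₂ 1 1 * S₁ 2 2 - S₁ 1 2 * S₂ 2 1 - S₂ 1 2 * S₁ 2 1)) * (((d₂ : ℝ) - (d₁ : ℝ)) ^ 2 * ((d₂ : ℝ) - 2 * (d₁ : ℝ))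
      * (2 * (d₂ : ℝ) - (d₁ : ℝ))) = (-36 * (d₁ : ℝ) * (d₂ : ℝ) * ((d₂ : ℝ) + 2 * (d₁ : ℝ)) * (2 * (d₂ : ℝ) + (d₁ : ℝ))) := by
    have e : ((d₁ : ℝ) ^ 2 * (d₂ : ℝ) ^ 2) * ((S₁ 0 0 * S₂ 1 1 + S₂ 0 0 * S₁ 1 1 - S₁ 0 1 * S₂ 1 0 - S₂ 0 1 * S₁ 1 0 + (S₁ 0 0 * S₂ 2 2 + S₂ 0 0
        * S₁ 2 2 - S₁ 0 2 * S₂ 2 0 - S₂ 0 2 * S₁ 2 0) + (S₁ 1 1 * S₂ 2 2 + S₂ 1 1 * S₁ 2 2 - S₁ 1 2 * S₂ 2 1 - S₂ 1 2 * S₁ 2 1)) * (((d₂ : ℝ)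
        - (d₁ : ℝ)) ^ 2 * ((d₂ : ℝ) - 2 * (d₁ : ℝ)) * (2 * (d₂ : ℝ) - (d₁ : ℝ))) - (-36 * (d₁ : ℝ) * (d₂ : ℝ) * ((d₂ : ℝ) + 2 * (d₁ : ℝ)) * (2
        * (d₂ : ℝ) + (d₁ : ℝ)))) = 0 := by linear_combination R4
    have e2 := (mul_eq_zero.mp e).resolve_left K4
    linarith
  have R5 := two_point_relation' (Finset.univ : Finset (Fin 10)) _ _ h9 hcard (i₀ := 0) (i := 5)
    (Finset.mem_univ _) (Finset.mem_univ _) (by decide)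
  simp [Fin.prod_univ_succ] at R5
  have K5 : (2 * (d₁ : ℝ) * (d₂ : ℝ) ^ 2) ≠ 0 := 
    mul_ne_zero (mul_ne_zero (by norm_num) n_a) (pow_ne_zero _ n_b)
  have C5 : (S₂ 0 0 * S₂ 1 1 - S₂ 0 1 * S₂ 1 0 + (S₂ 0 0 * S₂ 2 2 - S₂ 0 2 * S₂ 2 0) + (S₂ 1 1 * S₂ 2 2 - S₂ 1 2 * S₂ 2 1)) * (((d₂ : ℝ)
      - (d₁ : ℝ)) ^ 2 * ((d₂ : ℝ) - 2 * (d₁ : ℝ)) * (2 * (d₂ : ℝ) - (d₁ : ℝ)) * (2 * (d₂ : ℝ) - 3 * (d₁ : ℝ))) = (-9 * (d₁ : ℝ) ^ 2 * ((d₂ : ℝ)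
      + (d₁ : ℝ)) * ((d₂ : ℝ) + 2 * (d₁ : ℝ)) * (2 * (d₂ : ℝ) + (d₁ : ℝ))) := by
    have e : (2 * (d₁ : ℝ) * (d₂ : ℝ) ^ 2) * ((S₂ 0 0 * S₂ 1 1 - S₂ 0 1 * S₂ 1 0 + (S₂ 0 0 * S₂ 2 2 - S₂ 0 2 * S₂ 2 0) + (S₂ 1 1 * S₂ 2 2 - S₂ 1 2
        * S₂ 2 1)) * (((d₂ : ℝ) - (d₁ : ℝ)) ^ 2 * ((d₂ : ℝ) - 2 * (d₁ : ℝ)) * (2 * (d₂ : ℝ) - (d₁ : ℝ)) * (2 * (d₂ : ℝ) - 3 * (d₁ : ℝ))) - (-9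
        * (d₁ : ℝ) ^ 2 * ((d₂ : ℝ) + (d₁ : ℝ)) * ((d₂ : ℝ) + 2 * (d₁ : ℝ)) * (2 * (d₂ : ℝ) + (d₁ : ℝ)))) = 0 := by linear_combination R5
    have e2 := (mul_eq_zero.mp e).resolve_left K5
    linarith
  have R6 := two_point_relation' (Finset.univ : Finset (Fin 10)) _ _ h9 hcard (i₀ := 0) (i := 6)
    (Finset.mem_univ _) (Finset.mem_univ _) (by decide)
  simp [Fin.prod_univ_succ] at R6
  have K6 : (12 * (d₁ : ℝ) ^ 2) ≠ 0 := 
    mul_ne_zero (by norm_num) (pow_ne_zero _ n_a)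
  have C6 : S₁.det * (((d₂ : ℝ) - (d₁ : ℝ)) ^ 3 * ((d₂ : ℝ) - 2 * (d₁ : ℝ)) * ((d₂ : ℝ) - 3 * (d₁ : ℝ)) * (2 * (d₂ : ℝ) - 3
      * (d₁ : ℝ))) = (-((d₂ : ℝ) ^ 3) * ((d₂ : ℝ) + (d₁ : ℝ)) * ((d₂ : ℝ) + 2 * (d₁ : ℝ)) * (2 * (d₂ : ℝ) + (d₁ : ℝ))) := by
    have e : (12 * (d₁ : ℝ) ^ 2) * (S₁.det * (((d₂ : ℝ) - (d₁ : ℝ)) ^ 3 * ((d₂ : ℝ) - 2 * (d₁ : ℝ)) * ((d₂ : ℝ) - 3 * (d₁ : ℝ)) * (2 * (d₂ : ℝ) - 3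
        * (d₁ : ℝ))) - (-((d₂ : ℝ) ^ 3) * ((d₂ : ℝ) + (d₁ : ℝ)) * ((d₂ : ℝ) + 2 * (d₁ : ℝ)) * (2 * (d₂ : ℝ)
        + (d₁ : ℝ)))) = 0 := by linear_combination R6
    have e2 := (mul_eq_zero.mp e).resolve_left K6
    linarith
  have R7 := two_point_relation' (Finset.univ : Finset (Fin 10)) _ _ h9 hcard (i₀ := 0) (i := 7)
    (Finset.mem_univ _) (Finset.mem_univ _) (by decide)
  simp [Fin.prod_univ_succ] at R7
  have K7 : (-4 * (d₁ : ℝ) ^ 2 * (d₂ : ℝ) * ((d₁ : ℝ) + (d₂ : ℝ))) ≠ 0 := 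
    mul_ne_zero (mul_ne_zero (mul_ne_zero (by norm_num) (pow_ne_zero _ n_a)) n_b) n_apb
  have C7 : (S₁.adjugate * S₂).trace * (((d₂ : ℝ) - (d₁ : ℝ)) ^ 3 * ((d₂ : ℝ) - 2 * (d₁ : ℝ))) = (9 * (d₁ : ℝ) * (d₂ : ℝ) ^ 2 * (2 * (d₂ : ℝ) + (d₁ : ℝ))) := by
    have e : (-4 * (d₁ : ℝ) ^ 2 * (d₂ : ℝ) * ((d₁ : ℝ) + (d₂ : ℝ))) * ((S₁.adjugate * S₂).trace * (((d₂ : ℝ) - (d₁ : ℝ)) ^ 3 * ((d₂ : ℝ) - 2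
        * (d₁ : ℝ))) - (9 * (d₁ : ℝ) * (d₂ : ℝ) ^ 2 * (2 * (d₂ : ℝ) + (d₁ : ℝ)))) = 0 := by linear_combination R7
    have e2 := (mul_eq_zero.mp e).resolve_left K7
    linarith
  have R8 := two_point_relation' (Finset.univ : Finset (Fin 10)) _ _ h9 hcard (i₀ := 0) (i := 8)
    (Finset.mem_univ _) (Finset.mem_univ _) (by decide)
  simp [Fin.prod_univ_succ] at R8
  have K8 : (-4 * (d₁ : ℝ) * (d₂ : ℝ) ^ 2 * ((d₁ : ℝ) + (d₂ : ℝ))) ≠ 0 := 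
    mul_ne_zero (mul_ne_zero (mul_ne_zero (by norm_num) n_a) (pow_ne_zero _ n_b)) n_apb
  have C8 : (S₂.adjugate * S₁).trace * (((d₂ : ℝ) - (d₁ : ℝ)) ^ 3 * (2 * (d₂ : ℝ) - (d₁ : ℝ))) = (9 * (d₁ : ℝ) ^ 2 * (d₂ : ℝ) * ((d₂ : ℝ) + 2 * (d₁ : ℝ))) := by
    have e : (-4 * (d₁ : ℝ) * (d₂ : ℝ) ^ 2 * ((d₁ : ℝ) + (d₂ : ℝ))) * ((S₂.adjugate * S₁).trace * (((d₂ : ℝ) - (d₁ : ℝ)) ^ 3 * (2 * (d₂ : ℝ)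
        - (d₁ : ℝ))) - (9 * (d₁ : ℝ) ^ 2 * (d₂ : ℝ) * ((d₂ : ℝ) + 2 * (d₁ : ℝ)))) = 0 := by linear_combination R8
    have e2 := (mul_eq_zero.mp e).resolve_left K8
    linarith
  have R9 := two_point_relation' (Finset.univ : Finset (Fin 10)) _ _ h9 hcard (i₀ := 0) (i := 9)
    (Finset.mem_univ _) (Finset.mem_univ _) (by decide)
  simp [Fin.prod_univ_succ] at R9
  have K9 : (12 * (d₂ : ℝ) ^ 2) ≠ 0 := 
    mul_ne_zero (by norm_num) (pow_ne_zero _ n_b)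
  have C9 : S₂.det * (((d₂ : ℝ) - (d₁ : ℝ)) ^ 3 * (2 * (d₂ : ℝ) - (d₁ : ℝ)) * (3 * (d₂ : ℝ) - (d₁ : ℝ)) * (3 * (d₂ : ℝ) - 2
      * (d₁ : ℝ))) = (-((d₁ : ℝ) ^ 3) * ((d₂ : ℝ) + (d₁ : ℝ)) * ((d₂ : ℝ) + 2 * (d₁ : ℝ)) * (2 * (d₂ : ℝ) + (d₁ : ℝ))) := by
    have e : (12 * (d₂ : ℝ) ^ 2) * (S₂.det * (((d₂ : ℝ) - (d₁ : ℝ)) ^ 3 * (2 * (d₂ : ℝ) - (d₁ : ℝ)) * (3 * (d₂ : ℝ) - (d₁ : ℝ)) * (3 * (d₂ : ℝ) - 2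
        * (d₁ : ℝ))) - (-((d₁ : ℝ) ^ 3) * ((d₂ : ℝ) + (d₁ : ℝ)) * ((d₂ : ℝ) + 2 * (d₁ : ℝ)) * (2 * (d₂ : ℝ)
        + (d₁ : ℝ)))) = 0 := by linear_combination R9
    have e2 := (mul_eq_zero.mp e).resolve_left K9
    linarith
  exact ⟨C1, C2, C3, C4, C5, C6, C7, C8, C9⟩

/-! ## 3. Polarisation of `tr`, `e₂`, `det` along a two-letter combination -/

/-- `e₂(α·A + β·B) = α²e₂(A) + αβ·e₂(A,B) + β²e₂(B)`. [folklore] -/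
theorem e2_lin_comb (A B : Matrix (Fin 3) (Fin 3) ℝ) (α β : ℝ) :
    ((α • A + β • B) 0 0 * (α • A + β • B) 1 1 - (α • A + β • B) 0 1 * (α • A + β • B) 1 0 + ((α • A + β • B) 0 0 * (α • A + β • B) 2 2 - (α • A
        + β • B) 0 2 * (α • A + β • B) 2 0) + ((α • A + β • B) 1 1 * (α • A + β • B) 2 2 - (α • A + β • B) 1 2 * (α • A + β • B) 2 1))
      = α ^ 2 * (A 0 0 * A 1 1 - A 0 1 * A 1 0 + (A 0 0 * A 2 2 - A 0 2 * A 2 0) + (A 1 1 * A 2 2 - A 1 2 * A 2 1)) + α * β * (A 0 0 * B 1 1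
          + B 0 0 * A 1 1 - A 0 1 * B 1 0 - B 0 1 * A 1 0 + (A 0 0 * B 2 2 + B 0 0 * A 2 2 - A 0 2 * B 2 0 - B 0 2 * A 2 0) + (A 1 1 * B 2 2
          + B 1 1 * A 2 2 - A 1 2 * B 2 1 - B 1 2 * A 2 1)) + β ^ 2 * (B 0 0 * B 1 1 - B 0 1 * B 1 0 + (B 0 0 * B 2 2 - B 0 2 * B 2 0) + (B 1 1
          * B 2 2 - B 1 2 * B 2 1)) := by
  simp only [Matrix.add_apply, Matrix.smul_apply, smul_eq_mul]
  ring

/-- `det(α·A + β·B) = α³det A + α²β·tr(adj A·B) + αβ²·tr(adj B·A) + β³det B`. [folklore] -/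
theorem det_lin_comb (A B : Matrix (Fin 3) (Fin 3) ℝ) (α β : ℝ) :
    (α • A + β • B).det
      = α ^ 3 * A.det + α ^ 2 * β * (A.adjugate * B).trace + α * β ^ 2 * (B.adjugate * A).trace + β ^ 3 * B.det := by
  simp only [Matrix.det_fin_three, Matrix.adjugate_fin_three, Matrix.trace_fin_three, Matrix.mul_apply, Fin.sum_univ_three,
    Matrix.add_apply, Matrix.smul_apply, smul_eq_mul]
  simp
  ring

end Summit.ValiantsHypothesis.ValiantsHypothesis.Theorems.LacunarySymmetroidMatrixDescartes.Census.ConfluentNine
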